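import Summits.CriticalPhenomena.PercolationContinuityZ3.Theorems.PercNearOneGluingNoHeavyLowerTailKnQuestion8PocketAttach
import Summits.CriticalPhenomena.PercolationContinuityZ3.Theorems.PercNearOneGluingNoHeavyLowerTailPocketCSHDefs
import Summits.CriticalPhenomena.PercolationContinuityZ3.Theorems.PercNearOneGluingNoHeavyLowerTailHullPortCSHFourPT
import HarnessLib

/-!
# Kozma–Nitzan's Question 8 — the POCKET PEEL inequality (PEEL-D) for every avoided set, PROVED
# (four applications of van den Berg–Häggström–Kahn's Theorem 2.1 with the sets `S = {x, o}`, `T = Y`)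

Support file (`--supports stmt-CriticalPhenomena-4575`, closed crux; independent mathematics on Kozma–Nitzan's Question 8
(arXiv:2401.12397 §5.5 p. 36)), prover `prim-ineq-gen-7` (gen 11).  No definitions, no named facts, no sorries; standard axioms.
Memo `run/shared/lean/prim/prim-ineq-gen-7/FINDING-PEELD-g11.md`.

THE INEQUALITY.  Owner `x`, observer `o`, an avoided vertex SET `Y`, a down-closed pocket family `𝒟` of vertex sets none of which
meets `Y` (Question 8: `𝒟 = {W | W ∩ A = ∅}`, `Y = A ∖ {x}`), `P = {C_o ∈ 𝒟}`, `N = {x ↮ Y}`, `O = {x ↔ o}`; an integrand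
`g = F(C_x) − H(C_Y)` with `F` monotone on vertex sets and `H` monotone on the open edge cluster `C_Y = ⋃_{y ∈ Y} C_y` of the SET `Y`
(e.g. `H(C_Y) = F'(C_c)` for a relay `c ∈ Y` — the Question-8 integrand `F(C_x) − F(C_c)`).  Then
* `PocketCert.peel_of_pocket` —  `μ(N ∩ O) · ∫_{N ∩ P} g ≤ μ(N ∩ P) · ∫_{N ∩ O} g`,
  i.e. `E[F(C_x) − H(C_Y) | x ↔ o, x ↮ Y] ≥ E[F(C_x) − H(C_Y) | C_o ∈ 𝒟, x ↮ Y]`.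
This is conjecture (PEEL-D) of the cell memo prim-ineq-gen-7/FINDING-Q8-POCKET-g10.md §1 (`T ≥ λ_k·J_k`; census 0 / 1 570, proved there
for `|Y| = 1` only) = nonnegativity of the plain-observer bracket of the pocket conditioned slack hierarchy, `PocketCSH.pCovD … g o ≥ 0`
(`pCovD_obs_nonneg_sub/_edge` below); with that memo's peel identity it reduces Question 8 for EVERY `|A|` to the two-observer transfer (PS5)
alone, and Question 8 at `|A| = 3` to ONE five-point inequality (PCSH₀ at `Y = {c}` = prim-lf-2's PCOV) — memo FINDING-PEELD-g11.md §2.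
PROOF.  All four events lie in `D = {S ↮ T}` for `S = {x, o}`, `T = Y` (`x ↔ o ∧ x ↮ Y ⇒ o ↮ Y`; `C_o ∈ 𝒟 ⇒ o ↮ Y`).  Read through
`KNSep.reachable_iff_cluster`, `F(C_x)` and `1{x ↔ o}` are increasing and `1{C_o ∈ 𝒟}` is decreasing functions of the edge cluster `C_S`,
while `H(C_Y)` is an increasing function of `C_T`.  van den Berg–Häggström–Kahn's Theorem 2.1 at `q = 1` gives, conditionally on `D`,
`Cov(1_O, F) ≥ 0`, `Cov(1_P, F) ≤ 0` (`BHK2006_setClusterConditionalPositiveAssociation`; this half is prim-lf-2's `PocketCert.attach_of_pocket`)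
and `Cov(1_O, H) ≤ 0`, `Cov(1_P, H) ≥ 0` (`BHK2006_twoSetConditionalAssociation.negCorrelation`); the four are combined denominator-free.
[cite: VandenbergHaggstromKahn2005, Thm. 2.1 (p. 9), Remark 1 after Thm. 1.2 (p. 5)] [cite: KozmaNitzan2024, Question 8 (§5.5 p. 36)]
-/

namespace Summit.CriticalPhenomena.PercolationContinuityZ3.Theorems

open MeasureTheory Set Literature.Probability.LatticeModels Literature.Probability.Percolation
open scoped Classical
open KNPreFKG

noncomputable section

namespace PocketCert

variable {V : Type*} [Fintype V]

/-- Bookkeeping: from `fD·a ≤ d·fO`, `d·fP ≤ π·fD`, `d·hO ≤ a·hD`, `π·hD ≤ d·hP` (all masses nonnegative, `a, π ≤ d`) conclude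
`a·(fP − hP) ≤ π·(fO − hO)`. [folklore] -/
theorem peel_arith {d a π fD fO fP hD hO hP : ℝ} (hd : 0 ≤ d) (ha : 0 ≤ a) (hπ : 0 ≤ π) (had : a ≤ d) (hπd : π ≤ d)
    (h1 : fD * a ≤ d * fO) (h2 : d * fP ≤ π * fD) (h3 : d * hO ≤ a * hD) (h4 : π * hD ≤ d * hP) :
    a * (fP - hP) ≤ π * (fO - hO) := by
  by_cases hd0 : d = 0
  · have ha0 : a = 0 := le_antisymm (hd0 ▸ had) ha
    have hπ0 : π = 0 := le_antisymm (hd0 ▸ hπd) hπ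
    rw [ha0, hπ0]; simp
  have hdpos : 0 < d := lt_of_le_of_ne hd (Ne.symm hd0)
  have e1 : d * (a * fP) ≤ d * (π * fO) := by nlinarith [mul_le_mul_of_nonneg_left h2 ha, mul_le_mul_of_nonneg_left h1 hπ]
  have e2 : d * (π * hO) ≤ d * (a * hP) := by nlinarith [mul_le_mul_of_nonneg_left h3 hπ, mul_le_mul_of_nonneg_left h4 ha]
  nlinarith [le_of_mul_le_mul_left e1 hdpos, le_of_mul_le_mul_left e2 hdpos]

/-- **(PEEL-D) — the pocket peel inequality, every avoided set, every pocket family.**  `𝒟` down-closed, no pocket meets `Y`;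
`P = {C_o ∈ 𝒟}`, `N = {x ↮ Y}`, `O = {x ↔ o}`; `F` monotone on vertex sets, `H` monotone on edge sets (read on `C_Y = ⋃_{y∈Y} C_y`).  Then
`μ(N ∩ O) · ∫_{N ∩ P} (F(C_x) − H(C_Y)) ≤ μ(N ∩ P) · ∫_{N ∩ O} (F(C_x) − H(C_Y))`.
[cite: VandenbergHaggstromKahn2005, Thm. 2.1 (p. 9)] [cite: KozmaNitzan2024, Question 8 (§5.5 p. 36)] -/
theorem peel_of_pocket (w : Sym2 V → unitInterval) (o x : V) (Y : Set V) (𝒟 : Set (Set V)) (h𝒟 : IsLowerSet 𝒟)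
    (hY : ∀ W ∈ 𝒟, ∀ y ∈ Y, y ∉ W) (F : Set V → ℝ) (hF : ∀ S T : Set V, S ⊆ T → F S ≤ F T)
    (H : Set (Sym2 V) → ℝ) (hH : Monotone H) :
    (prodBernoulli w).real ({ω : BondConfig V | ∀ y ∈ Y, ¬ (openGraph ω).Reachable x y} ∩ openConn x o) *
        ∫ ω in {ω : BondConfig V | ∀ y ∈ Y, ¬ (openGraph ω).Reachable x y} ∩ {ω | openCluster ω o ∈ 𝒟},
          (F (openCluster ω x) - H (⋃ y ∈ Y, openEdgeCluster ω y)) ∂(prodBernoulli w) ≤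
      (prodBernoulli w).real ({ω : BondConfig V | ∀ y ∈ Y, ¬ (openGraph ω).Reachable x y} ∩ {ω | openCluster ω o ∈ 𝒟}) *
        ∫ ω in {ω : BondConfig V | ∀ y ∈ Y, ¬ (openGraph ω).Reachable x y} ∩ openConn x o,
          (F (openCluster ω x) - H (⋃ y ∈ Y, openEdgeCluster ω y)) ∂(prodBernoulli w) := by
  classical
  set μ := prodBernoulli w with hμ
  set f : BondConfig V → ℝ := fun ω => F (openCluster ω x) with hf
  set h : BondConfig V → ℝ := fun ω => H (⋃ y ∈ Y, openEdgeCluster ω y) with hh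
  have hmeas : ∀ S' : Set (BondConfig V), MeasurableSet S' := fun _ => MeasurableSet.of_discrete
  have hn := fun (S' : Set (BondConfig V)) => (measureReal_nonneg : 0 ≤ μ.real S')
  have hint : ∀ (g : BondConfig V → ℝ) (S' : Set (BondConfig V)), IntegrableOn g S' μ := fun g S' => (Integrable.of_finite).integrableOn
  set S : Set V := {x, o} with hS
  set T : Set V := Y with hT
  set D : Set (BondConfig V) := {ω : BondConfig V | ∀ s ∈ S, ∀ t ∈ T, ¬ (openGraph ω).Reachable s t} with hD
  set N : Set (BondConfig V) := {ω : BondConfig V | ∀ y ∈ Y, ¬ (openGraph ω).Reachable x y} with hN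
  set P : Set (BondConfig V) := {ω : BondConfig V | openCluster ω o ∈ 𝒟} with hP
  -- monotone functions of the edge cluster of `S`
  set Fe : Set (Sym2 V) → ℝ := fun C => F (openCluster C x) with hFe
  set Ge : Set (Sym2 V) → ℝ := fun C => (openCluster C x).indicator (1 : V → ℝ) o with hGe
  set He : Set (Sym2 V) → ℝ := fun C => if openCluster C o ∈ 𝒟 then 0 else 1 with hHe
  have hFe_mono : Monotone Fe := fun C C' hCC' => hF _ _ (openCluster_mono hCC' x)
  have hGe_mono : Monotone Ge := by
    intro C C' hCC'
    simp only [hGe]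
    by_cases hm : o ∈ openCluster C x
    · rw [indicator_of_mem hm, indicator_of_mem (openCluster_mono hCC' x hm)]
    · rw [indicator_of_notMem hm]
      by_cases hm' : o ∈ openCluster C' x
      · rw [indicator_of_mem hm']; simp
      · rw [indicator_of_notMem hm']
  have hHe_mono : Monotone He := by
    intro C C' hCC'
    simp only [hHe]
    by_cases h' : openCluster C' o ∈ 𝒟
    · rw [if_pos h', if_pos (h𝒟 (openCluster_mono hCC' o) h')]
    · rw [if_neg h']; split_ifs <;> norm_num
  have hxS : x ∈ S := by simp [hS]
  have hoS : o ∈ S := by simp [hS]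
  have hclx : ∀ ω : BondConfig V, openCluster (⋃ s ∈ S, openEdgeCluster ω s) x = openCluster ω x := by
    intro ω; ext a; exact (KNSep.reachable_iff_cluster ω S hxS a).symm
  have hclo : ∀ ω : BondConfig V, openCluster (⋃ s ∈ S, openEdgeCluster ω s) o = openCluster ω o := by
    intro ω; ext a; exact (KNSep.reachable_iff_cluster ω S hoS a).symm
  have hFe_eq : ∀ ω : BondConfig V, Fe (⋃ s ∈ S, openEdgeCluster ω s) = f ω := by
    intro ω; simp only [hFe, hf, hclx ω]
  have hGe_eq : ∀ ω : BondConfig V, Ge (⋃ s ∈ S, openEdgeCluster ω s) = (openConn x o : Set (BondConfig V)).indicator 1 ω := by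
    intro ω; simp only [hGe, hclx ω]
    by_cases hr : (openGraph ω).Reachable x o
    · rw [indicator_of_mem (show o ∈ openCluster ω x from hr), indicator_of_mem (show ω ∈ openConn x o from hr)]
      simp
    · rw [indicator_of_notMem (show o ∉ openCluster ω x from hr), indicator_of_notMem (show ω ∉ openConn x o from hr)]
  have hHe_eq : ∀ ω : BondConfig V, He (⋃ s ∈ S, openEdgeCluster ω s) = (Pᶜ : Set (BondConfig V)).indicator 1 ω := by
    intro ω; simp only [hHe, hclo ω]
    by_cases hm : openCluster ω o ∈ 𝒟
    · rw [if_pos hm, indicator_of_notMem (show ω ∉ (Pᶜ : Set (BondConfig V)) from fun hc => hc hm)]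
    · rw [if_neg hm, indicator_of_mem (show ω ∈ (Pᶜ : Set (BondConfig V)) from hm), Pi.one_apply]
  have hh_eq : ∀ ω : BondConfig V, H (⋃ t ∈ T, openEdgeCluster ω t) = h ω := fun ω => rfl
  -- the events inside `D`
  have hDsub : D ⊆ N := fun ω hd y hy => hd x hxS y (by simpa [hT] using hy)
  have hDO : D ∩ openConn x o = N ∩ openConn x o := by
    ext ω
    constructor
    · rintro ⟨hd, hxo⟩
      exact ⟨hDsub hd, hxo⟩
    · rintro ⟨hNω, hxo⟩
      refine ⟨?_, hxo⟩
      simp only [hD, hS, mem_setOf_eq, mem_insert_iff, mem_singleton_iff, forall_eq_or_imp, forall_eq]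
      refine ⟨fun t ht => hNω t (by simpa [hT] using ht), fun t ht hot => hNω t (by simpa [hT] using ht) ?_⟩
      exact (show (openGraph ω).Reachable x o from hxo).trans hot
  have hDP : D ∩ P = N ∩ P := by
    ext ω
    constructor
    · rintro ⟨hd, hp⟩
      exact ⟨hDsub hd, hp⟩
    · rintro ⟨hNω, hp⟩
      refine ⟨?_, hp⟩
      simp only [hD, hS, mem_setOf_eq, mem_insert_iff, mem_singleton_iff, forall_eq_or_imp, forall_eq]
      refine ⟨fun t ht => hNω t (by simpa [hT] using ht), fun t ht hot => ?_⟩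
      exact hY _ hp t (by simpa [hT] using ht) hot
  have hDPc : D ∩ Pᶜ = D \ (D ∩ P) := by
    ext ω; constructor
    · rintro ⟨hd, hnp⟩; exact ⟨hd, fun h2 => hnp h2.2⟩
    · rintro ⟨hd, hnp⟩; exact ⟨hd, fun hp => hnp ⟨hd, hp⟩⟩
  have hsub' : D ∩ P ⊆ D := inter_subset_left
  have eP : μ.real (D ∩ Pᶜ) = μ.real D - μ.real (D ∩ P) := by
    rw [hDPc]
    have hu := measureReal_union (μ := μ) (Set.disjoint_sdiff_right : Disjoint (D ∩ P) (D \ (D ∩ P))) (hmeas _)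
    rw [Set.union_sdiff_cancel hsub'] at hu
    linarith
  have iP : ∀ g : BondConfig V → ℝ, ∫ ω in D ∩ Pᶜ, g ω ∂μ = (∫ ω in D, g ω ∂μ) - ∫ ω in D ∩ P, g ω ∂μ := by
    intro g
    rw [hDPc]
    have hu := setIntegral_union (μ := μ) (f := g) (Set.disjoint_sdiff_right : Disjoint (D ∩ P) (D \ (D ∩ P))) (hmeas _)
      (hint g _) (hint g _)
    rw [Set.union_sdiff_cancel hsub'] at hu
    linarith
  -- (1) `F(C_x)` and `1{x↔o}`: positively correlated given `D`
  have h1 := BHK2006_setClusterConditionalPositiveAssociation w S T Fe Ge hFe_mono hGe_mono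
  simp_rw [hFe_eq, hGe_eq] at h1
  rw [setIntegral_indicator_one_eq μ D (openConn x o), setIntegral_mul_indicator_one μ D (openConn x o) f] at h1
  -- (2) `F(C_x)` and `1{C_o ∉ 𝒟}`: positively correlated given `D`
  have h2 := BHK2006_setClusterConditionalPositiveAssociation w S T Fe He hFe_mono hHe_mono
  simp_rw [hFe_eq, hHe_eq] at h2
  rw [setIntegral_indicator_one_eq μ D (Pᶜ), setIntegral_mul_indicator_one μ D (Pᶜ) f, eP, iP] at h2
  -- (3) `1{x↔o}` (function of `C_S`) and `H(C_T)`: negatively correlated given `D`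
  have h3 := BHK2006_twoSetConditionalAssociation.negCorrelation w S T Ge H hGe_mono hH
  simp_rw [hGe_eq, hh_eq] at h3
  rw [setIntegral_indicator_one_eq μ D (openConn x o)] at h3
  have e3 : ∫ ω in D, (openConn x o : Set (BondConfig V)).indicator (1 : BondConfig V → ℝ) ω * h ω ∂μ =
      ∫ ω in D ∩ openConn x o, h ω ∂μ := by
    rw [← setIntegral_mul_indicator_one μ D (openConn x o) h]
    exact setIntegral_congr_fun (hmeas D) fun ω _ => mul_comm _ _
  rw [e3] at h3
  -- (4) `1{C_o ∉ 𝒟}` (function of `C_S`) and `H(C_T)`: negatively correlated given `D`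
  have h4 := BHK2006_twoSetConditionalAssociation.negCorrelation w S T He H hHe_mono hH
  simp_rw [hHe_eq, hh_eq] at h4
  rw [setIntegral_indicator_one_eq μ D (Pᶜ)] at h4
  have e4 : ∫ ω in D, (Pᶜ : Set (BondConfig V)).indicator (1 : BondConfig V → ℝ) ω * h ω ∂μ = ∫ ω in D ∩ Pᶜ, h ω ∂μ := by
    rw [← setIntegral_mul_indicator_one μ D (Pᶜ) h]
    exact setIntegral_congr_fun (hmeas D) fun ω _ => mul_comm _ _
  rw [e4, eP, iP] at h4
  -- rewrite the events of the statement
  rw [hDO] at h1 h3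
  rw [hDP] at h2 h4
  -- abbreviations
  set d := μ.real D with hd
  set a := μ.real (N ∩ openConn x o) with ha
  set π := μ.real (N ∩ P) with hπ
  set fD := ∫ ω in D, f ω ∂μ with hfD
  set fO := ∫ ω in N ∩ openConn x o, f ω ∂μ with hfO
  set fP := ∫ ω in N ∩ P, f ω ∂μ with hfP
  set gD := ∫ ω in D, h ω ∂μ with hgD
  set gO := ∫ ω in N ∩ openConn x o, h ω ∂μ with hgO
  set gP := ∫ ω in N ∩ P, h ω ∂μ with hgP
  have had : a ≤ d := by rw [ha, hd, ← hDO]; exact measureReal_mono inter_subset_left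
  have hπd : π ≤ d := by rw [hπ, hd, ← hDP]; exact measureReal_mono inter_subset_left
  -- h1 : fD * a ≤ d * fO ; h2 : fD * (d - π) ≤ d * (fD - fP) ; h3 : d * gO ≤ a * gD ; h4 : d * (gD - gP) ≤ (d - π) * gD
  have h2' : d * fP ≤ π * fD := by nlinarith [h2]
  have h4' : π * gD ≤ d * gP := by nlinarith [h4]
  have key := peel_arith (hn D) (hn _) (hn _) had hπd h1 h2' h3 h4'
  -- split the integrals of the difference
  have sO : ∫ ω in N ∩ openConn x o, (f ω - h ω) ∂μ = fO - gO := integral_sub (hint f _) (hint h _)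
  have sP : ∫ ω in N ∩ P, (f ω - h ω) ∂μ = fP - gP := integral_sub (hint f _) (hint h _)
  simp only [hf, hh] at sO sP
  rw [sO, sP]
  linarith [key]

omit [Fintype V] in
/-- For a relay `c ∈ Y`, the cluster of `c` is read off the edge cluster of the set `Y`. [folklore] -/
theorem openCluster_biUnion_eq_of_mem (ω : BondConfig V) (Y : Set V) {c : V} (hc : c ∈ Y) :
    openCluster (⋃ y ∈ Y, openEdgeCluster ω y) c = openCluster ω c := by
  ext a; exact (KNSep.reachable_iff_cluster ω Y hc a).symm

/-- **(PEEL-D) for the Question-8 integrand `F(C_x) − F'(C_c)`, `c ∈ Y`.**  With `N = {x ↮ Y}`, `O = {x ↔ o}`, `P = {C_o ∈ 𝒟}`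
(`𝒟` down-closed, no pocket meets `Y`), `F, F'` monotone on vertex sets:
`μ(N ∩ O) · ∫_{N ∩ P} (F(C_x) − F'(C_c)) ≤ μ(N ∩ P) · ∫_{N ∩ O} (F(C_x) − F'(C_c))`.
[cite: VandenbergHaggstromKahn2005, Thm. 2.1 (p. 9)] [cite: KozmaNitzan2024, Question 8 (§5.5 p. 36)] -/
theorem peel_of_pocket_relay (w : Sym2 V → unitInterval) (o x c : V) (Y : Set V) (hc : c ∈ Y) (𝒟 : Set (Set V))
    (h𝒟 : IsLowerSet 𝒟) (hY : ∀ W ∈ 𝒟, ∀ y ∈ Y, y ∉ W) (F F' : Set V → ℝ) (hF : ∀ S T : Set V, S ⊆ T → F S ≤ F T)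
    (hF' : ∀ S T : Set V, S ⊆ T → F' S ≤ F' T) :
    (prodBernoulli w).real ({ω : BondConfig V | ∀ y ∈ Y, ¬ (openGraph ω).Reachable x y} ∩ openConn x o) *
        ∫ ω in {ω : BondConfig V | ∀ y ∈ Y, ¬ (openGraph ω).Reachable x y} ∩ {ω | openCluster ω o ∈ 𝒟},
          (F (openCluster ω x) - F' (openCluster ω c)) ∂(prodBernoulli w) ≤
      (prodBernoulli w).real ({ω : BondConfig V | ∀ y ∈ Y, ¬ (openGraph ω).Reachable x y} ∩ {ω | openCluster ω o ∈ 𝒟}) *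
        ∫ ω in {ω : BondConfig V | ∀ y ∈ Y, ¬ (openGraph ω).Reachable x y} ∩ openConn x o,
          (F (openCluster ω x) - F' (openCluster ω c)) ∂(prodBernoulli w) := by
  have key := peel_of_pocket w o x Y 𝒟 h𝒟 hY F hF (fun C => F' (openCluster C c))
    (fun C C' hCC' => hF' _ _ (openCluster_mono hCC' c))
  simp only [openCluster_biUnion_eq_of_mem _ Y hc] at key
  exact key

/-- **The plain-observer bracket of the pocket conditioned slack hierarchy is nonnegative** (integrand `F(C_x) − F'(C_c)`, `c ∈ Y`):
`0 ≤ PocketCSH.pCovD w o 𝒟 x Y (F(C_x) − F'(C_c)) o = μ(N ∩ P)·∫_{N ∩ {x↔o}} g − μ(N ∩ {x↔o})·∫_{N ∩ P} g` — level 0 of PCSH with an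
isolated second observer, i.e. (PEEL-D) of the cell memo FINDING-Q8-POCKET-g10.md §1–§3 (exact census 0 / 1 570), now a theorem.
[cite: KozmaNitzan2024, Question 8 (§5.5 p. 36)] [cite: VandenbergHaggstromKahn2005, Thm. 2.1 (p. 9)] -/
theorem pCovD_obs_nonneg_sub (w : Sym2 V → unitInterval) (o x c : V) (Y : Set V) (hc : c ∈ Y) (𝒟 : Set (Set V))
    (h𝒟 : IsLowerSet 𝒟) (hY : ∀ W ∈ 𝒟, ∀ y ∈ Y, y ∉ W) (F F' : Set V → ℝ) (hF : ∀ S T : Set V, S ⊆ T → F S ≤ F T)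
    (hF' : ∀ S T : Set V, S ⊆ T → F' S ≤ F' T) :
    0 ≤ PocketCSH.pCovD w o 𝒟 x Y (fun ω => F (openCluster ω x) - F' (openCluster ω c)) o := by
  rw [PocketCSH.pCovD_obs]
  have key := peel_of_pocket_relay w o x c Y hc 𝒟 h𝒟 hY F F' hF hF'
  simp only [PocketCSH.pocketEv]
  linarith [key]

/-- **(PEEL-D) for a monotone functional of the open EDGE cluster of `x`** (the second clause of `PocketCSH.PCSHHolds`, e.g.
`Ψ_iso = 1{C_x ≠ ∅}`): `μ(N ∩ O) · ∫_{N ∩ P} f(C_x) ≤ μ(N ∩ P) · ∫_{N ∩ O} f(C_x)`.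
[cite: VandenbergHaggstromKahn2005, Thm. 2.1 (p. 9)] [cite: KozmaNitzan2024, Question 8 (§5.5 p. 36)] -/
theorem peel_of_pocket_edge (w : Sym2 V → unitInterval) (o x : V) (Y : Set V) (𝒟 : Set (Set V)) (h𝒟 : IsLowerSet 𝒟)
    (hY : ∀ W ∈ 𝒟, ∀ y ∈ Y, y ∉ W) (f : Set (Sym2 V) → ℝ) (hf : Monotone f) :
    (prodBernoulli w).real ({ω : BondConfig V | ∀ y ∈ Y, ¬ (openGraph ω).Reachable x y} ∩ openConn x o) *
        ∫ ω in {ω : BondConfig V | ∀ y ∈ Y, ¬ (openGraph ω).Reachable x y} ∩ {ω | openCluster ω o ∈ 𝒟},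
          f (openEdgeCluster ω x) ∂(prodBernoulli w) ≤
      (prodBernoulli w).real ({ω : BondConfig V | ∀ y ∈ Y, ¬ (openGraph ω).Reachable x y} ∩ {ω | openCluster ω o ∈ 𝒟}) *
        ∫ ω in {ω : BondConfig V | ∀ y ∈ Y, ¬ (openGraph ω).Reachable x y} ∩ openConn x o,
          f (openEdgeCluster ω x) ∂(prodBernoulli w) := by
  classical
  set μ := prodBernoulli w with hμ
  set g : BondConfig V → ℝ := fun ω => f (openEdgeCluster ω x) with hg
  have hmeas : ∀ S' : Set (BondConfig V), MeasurableSet S' := fun _ => MeasurableSet.of_discrete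
  have hn := fun (S' : Set (BondConfig V)) => (measureReal_nonneg : 0 ≤ μ.real S')
  have hint : ∀ (g : BondConfig V → ℝ) (S' : Set (BondConfig V)), IntegrableOn g S' μ := fun g S' => (Integrable.of_finite).integrableOn
  set S : Set V := {x, o} with hS
  set T : Set V := Y with hT
  set D : Set (BondConfig V) := {ω : BondConfig V | ∀ s ∈ S, ∀ t ∈ T, ¬ (openGraph ω).Reachable s t} with hD
  set N : Set (BondConfig V) := {ω : BondConfig V | ∀ y ∈ Y, ¬ (openGraph ω).Reachable x y} with hN
  set P : Set (BondConfig V) := {ω : BondConfig V | openCluster ω o ∈ 𝒟} with hP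
  set Fe : Set (Sym2 V) → ℝ := fun C => f (openEdgeCluster C x) with hFe
  set Ge : Set (Sym2 V) → ℝ := fun C => (openCluster C x).indicator (1 : V → ℝ) o with hGe
  set He : Set (Sym2 V) → ℝ := fun C => if openCluster C o ∈ 𝒟 then 0 else 1 with hHe
  have hFe_mono : Monotone Fe := fun C C' hCC' => hf (BHK2006.openEdgeCluster_mono hCC' x)
  have hGe_mono : Monotone Ge := by
    intro C C' hCC'
    simp only [hGe]
    by_cases hm : o ∈ openCluster C x
    · rw [indicator_of_mem hm, indicator_of_mem (openCluster_mono hCC' x hm)]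
    · rw [indicator_of_notMem hm]
      by_cases hm' : o ∈ openCluster C' x
      · rw [indicator_of_mem hm']; simp
      · rw [indicator_of_notMem hm']
  have hHe_mono : Monotone He := by
    intro C C' hCC'
    simp only [hHe]
    by_cases h' : openCluster C' o ∈ 𝒟
    · rw [if_pos h', if_pos (h𝒟 (openCluster_mono hCC' o) h')]
    · rw [if_neg h']; split_ifs <;> norm_num
  have hxS : x ∈ S := by simp [hS]
  have hoS : o ∈ S := by simp [hS]
  have hclx : ∀ ω : BondConfig V, openCluster (⋃ s ∈ S, openEdgeCluster ω s) x = openCluster ω x := by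
    intro ω; ext a; exact (KNSep.reachable_iff_cluster ω S hxS a).symm
  have hclo : ∀ ω : BondConfig V, openCluster (⋃ s ∈ S, openEdgeCluster ω s) o = openCluster ω o := by
    intro ω; ext a; exact (KNSep.reachable_iff_cluster ω S hoS a).symm
  have hFe_eq : ∀ ω : BondConfig V, Fe (⋃ s ∈ S, openEdgeCluster ω s) = g ω := by
    intro ω; simp only [hFe, hg, HullPort.openEdgeCluster_biUnion_eq ω S hxS]
  have hGe_eq : ∀ ω : BondConfig V, Ge (⋃ s ∈ S, openEdgeCluster ω s) = (openConn x o : Set (BondConfig V)).indicator 1 ω := by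
    intro ω; simp only [hGe, hclx ω]
    by_cases hr : (openGraph ω).Reachable x o
    · rw [indicator_of_mem (show o ∈ openCluster ω x from hr), indicator_of_mem (show ω ∈ openConn x o from hr)]
      simp
    · rw [indicator_of_notMem (show o ∉ openCluster ω x from hr), indicator_of_notMem (show ω ∉ openConn x o from hr)]
  have hHe_eq : ∀ ω : BondConfig V, He (⋃ s ∈ S, openEdgeCluster ω s) = (Pᶜ : Set (BondConfig V)).indicator 1 ω := by
    intro ω; simp only [hHe, hclo ω]
    by_cases hm : openCluster ω o ∈ 𝒟
    · rw [if_pos hm, indicator_of_notMem (show ω ∉ (Pᶜ : Set (BondConfig V)) from fun hc => hc hm)]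
    · rw [if_neg hm, indicator_of_mem (show ω ∈ (Pᶜ : Set (BondConfig V)) from hm), Pi.one_apply]
  have hDsub : D ⊆ N := fun ω hd y hy => hd x hxS y (by simpa [hT] using hy)
  have hDO : D ∩ openConn x o = N ∩ openConn x o := by
    ext ω
    constructor
    · rintro ⟨hd, hxo⟩
      exact ⟨hDsub hd, hxo⟩
    · rintro ⟨hNω, hxo⟩
      refine ⟨?_, hxo⟩
      simp only [hD, hS, mem_setOf_eq, mem_insert_iff, mem_singleton_iff, forall_eq_or_imp, forall_eq]
      refine ⟨fun t ht => hNω t (by simpa [hT] using ht), fun t ht hot => hNω t (by simpa [hT] using ht) ?_⟩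
      exact (show (openGraph ω).Reachable x o from hxo).trans hot
  have hDP : D ∩ P = N ∩ P := by
    ext ω
    constructor
    · rintro ⟨hd, hp⟩
      exact ⟨hDsub hd, hp⟩
    · rintro ⟨hNω, hp⟩
      refine ⟨?_, hp⟩
      simp only [hD, hS, mem_setOf_eq, mem_insert_iff, mem_singleton_iff, forall_eq_or_imp, forall_eq]
      refine ⟨fun t ht => hNω t (by simpa [hT] using ht), fun t ht hot => ?_⟩
      exact hY _ hp t (by simpa [hT] using ht) hot
  have hDPc : D ∩ Pᶜ = D \ (D ∩ P) := by
    ext ω; constructor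
    · rintro ⟨hd, hnp⟩; exact ⟨hd, fun h2 => hnp h2.2⟩
    · rintro ⟨hd, hnp⟩; exact ⟨hd, fun hp => hnp ⟨hd, hp⟩⟩
  have hsub' : D ∩ P ⊆ D := inter_subset_left
  have eP : μ.real (D ∩ Pᶜ) = μ.real D - μ.real (D ∩ P) := by
    rw [hDPc]
    have hu := measureReal_union (μ := μ) (Set.disjoint_sdiff_right : Disjoint (D ∩ P) (D \ (D ∩ P))) (hmeas _)
    rw [Set.union_sdiff_cancel hsub'] at hu
    linarith
  have iP : ∀ g : BondConfig V → ℝ, ∫ ω in D ∩ Pᶜ, g ω ∂μ = (∫ ω in D, g ω ∂μ) - ∫ ω in D ∩ P, g ω ∂μ := by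
    intro g
    rw [hDPc]
    have hu := setIntegral_union (μ := μ) (f := g) (Set.disjoint_sdiff_right : Disjoint (D ∩ P) (D \ (D ∩ P))) (hmeas _)
      (hint g _) (hint g _)
    rw [Set.union_sdiff_cancel hsub'] at hu
    linarith
  have h1 := BHK2006_setClusterConditionalPositiveAssociation w S T Fe Ge hFe_mono hGe_mono
  simp_rw [hFe_eq, hGe_eq] at h1
  rw [setIntegral_indicator_one_eq μ D (openConn x o), setIntegral_mul_indicator_one μ D (openConn x o) g] at h1
  have h2 := BHK2006_setClusterConditionalPositiveAssociation w S T Fe He hFe_mono hHe_mono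
  simp_rw [hFe_eq, hHe_eq] at h2
  rw [setIntegral_indicator_one_eq μ D (Pᶜ), setIntegral_mul_indicator_one μ D (Pᶜ) g, eP, iP] at h2
  rw [hDO] at h1
  rw [hDP] at h2
  set d := μ.real D with hd
  set a := μ.real (N ∩ openConn x o) with ha
  set π := μ.real (N ∩ P) with hπ
  set fD := ∫ ω in D, g ω ∂μ with hfD
  set fO := ∫ ω in N ∩ openConn x o, g ω ∂μ with hfO
  set fP := ∫ ω in N ∩ P, g ω ∂μ with hfP
  have had : a ≤ d := by rw [ha, hd, ← hDO]; exact measureReal_mono inter_subset_left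
  have hπd : π ≤ d := by rw [hπ, hd, ← hDP]; exact measureReal_mono inter_subset_left
  have h2' : d * fP ≤ π * fD := by nlinarith [h2]
  have key := peel_arith (hd := hn D) (ha := hn _) (hπ := hn _) had hπd h1 h2' (hD := (0 : ℝ)) (hO := 0) (hP := 0)
    (by simp) (by simp)
  simp only [sub_zero] at key
  simpa [hg] using key

/-- **The plain-observer bracket is nonnegative for an edge-cluster functional**:
`0 ≤ PocketCSH.pCovD w o 𝒟 x Y (f ∘ C_x) o` (`f` monotone; e.g. `Ψ_iso`, the pocket "Lemma AC" at level 0).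
[cite: KozmaNitzan2024, Question 8 (§5.5 p. 36)] [cite: VandenbergHaggstromKahn2005, Thm. 2.1 (p. 9)] -/
theorem pCovD_obs_nonneg_edge (w : Sym2 V → unitInterval) (o x : V) (Y : Set V) (𝒟 : Set (Set V)) (h𝒟 : IsLowerSet 𝒟)
    (hY : ∀ W ∈ 𝒟, ∀ y ∈ Y, y ∉ W) (f : Set (Sym2 V) → ℝ) (hf : Monotone f) :
    0 ≤ PocketCSH.pCovD w o 𝒟 x Y (fun ω => f (openEdgeCluster ω x)) o := by
  rw [PocketCSH.pCovD_obs]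
  have key := peel_of_pocket_edge w o x Y 𝒟 h𝒟 hY f hf
  simp only [PocketCSH.pocketEv]
  linarith [key]

end PocketCert

end

end Summit.CriticalPhenomena.PercolationContinuityZ3.Theorems
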